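import Summits.Ventures.QEC.Census.CertBZPlaneMixed
import HarnessLib

/-!
# Lane engine: MONOTONICITY IN THE ALLOW-LIST, and a linear inclusion check for sorted lists (qec lane ε, type-10)

type-01's lane families (`Plane.familyOK` / `segOK`, qec-search-5's `topOK`) re-check every straggler lane with the
tree's leaf `bzLeaf wmax allow`, whose allow-list test is a LINEAR `List.elem`. When the allow-list is long (the level-2
list of the `[[288,12,18]]` cover certificate: 9 495 words, ≈ 16 000 straggler visits) that scan dominates the kernel
time by two orders of magnitude (measured: a 137 979-lane family with 878 stragglers replays in ≈ 25 s against its own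
878-word list and does not finish in 300 s against the 9 495-word list). Remedy: replay each family against ITS OWN short
list `allowₖ` and lift the verdict to the global list by monotonicity —
* `bzLeaf_mono_allow`, `failLoop_mono_allow`, `familyOK_mono_allow`, `segOK_mono_allow`, `topOK_mono_allow`:
  `allowₖ ⊆ allow` ⇒ a passing check against `allowₖ` passes against `allow`;
* `subWalk allowₖ allow` — ONE merge-style walk (both lists ascending; `O(|allow|)`) with `mem_of_subWalk` (sound for
  any lists: `true` ⇒ `allowₖ ⊆ allow`).
HONEST FRAMING: generic glue over type-01's / search-5's definitions; theorems + one Bool definition; standard axioms.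
-/

set_option autoImplicit false

namespace Summit.Ventures.QEC.Census.Plane

open List

variable {wmax : ℕ} {allow allow' : List ℕ}

/-- The tree's leaf is monotone in the allow-list. -/
theorem bzLeaf_mono_allow (h : ∀ w ∈ allow, w ∈ allow') {u c : ℕ} (hl : bzLeaf wmax allow u c = true) :
    bzLeaf wmax allow' u c = true := by
  simp only [bzLeaf, Bool.or_eq_true] at hl ⊢
  rcases hl with hl | hl
  · exact Or.inl hl
  · exact Or.inr (List.elem_eq_true_of_mem (h _ (List.mem_of_elem_eq_true hl)))

/-- A lane's leaf is monotone in the allow-list. -/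
theorem laneLeaf_mono_allow (h : ∀ w ∈ allow, w ∈ allow') {G chis : List ℕ} {b : ℕ}
    (hl : laneLeaf wmax allow G chis b = true) : laneLeaf wmax allow' G chis b = true :=
  bzLeaf_mono_allow h hl

/-- The straggler loop is monotone in the allow-list. -/
theorem failLoop_mono_allow (h : ∀ w ∈ allow, w ∈ allow') {G chis : List ℕ} :
    ∀ (fuel F : ℕ), failLoop wmax allow G chis fuel F = true → failLoop wmax allow' G chis fuel F = true
  | 0, F, hF => by rw [failLoop] at hF ⊢; exact hF
  | fuel + 1, F, hF => by
    rw [failLoop] at hF ⊢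
    revert hF
    cases Nat.beq F 0 with
    | true => exact id
    | false =>
      simp only [cond_false, Bool.and_eq_true]
      exact fun hF => ⟨laneLeaf_mono_allow h hF.1, failLoop_mono_allow h fuel _ hF.2⟩

/-- A lane family check is monotone in the allow-list. -/
theorem familyOK_mono_allow (h : ∀ w ∈ allow, w ∈ allow') {cols G : List ℕ} {fam : ℕ × List ℕ} {θ fuel : ℕ}
    (hf : familyOK wmax cols allow G fam θ fuel = true) : familyOK wmax cols allow' G fam θ fuel = true :=
  failLoop_mono_allow h _ _ hf

/-- **Segment checks are monotone in the allow-list**: replay against a short list, conclude for the long one. -/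
theorem segOK_mono_allow (h : ∀ w ∈ allow, w ∈ allow') {n : ℕ} {G : List ℕ} {t m0 s fuel : ℕ}
    (hs : segOK n wmax allow G t m0 s fuel = true) : segOK n wmax allow' G t m0 s fuel = true :=
  familyOK_mono_allow h hs

/-- **Top-family checks are monotone in the allow-list.** -/
theorem topOK_mono_allow (h : ∀ w ∈ allow, w ∈ allow') {ncols : ℕ} {G : List ℕ} {c t k : ℕ} {P : List ℕ}
    {fuel : ℕ} (ht : topOK ncols wmax allow G c t k P fuel = true) : topOK ncols wmax allow' G c t k P fuel = true :=
  familyOK_mono_allow h ht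

/-! ## A linear inclusion check -/

/-- Merge-style inclusion walk: with both lists sorted ascending it matches every element of the first list in ONE pass
over the second (structural on the second list; sound — `true` ⇒ inclusion — for arbitrary lists). (definition) -/
def subWalk : List ℕ → List ℕ → Bool
  | [], _ => true
  | _ :: _, [] => false
  | a :: as, b :: bs => if a == b then subWalk as bs else subWalk (a :: as) bs

/-- Soundness of the walk: every element of the first list occurs in the second. -/
theorem mem_of_subWalk : ∀ (l m : List ℕ), subWalk l m = true → ∀ w ∈ l, w ∈ m
  | [], _, _ => fun w hw => absurd hw List.not_mem_nil
  | a :: as, [], h => by simp [subWalk] at h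
  | a :: as, b :: bs, h => by
    intro w hw
    unfold subWalk at h
    by_cases hab : a = b
    · subst hab
      rw [if_pos (beq_self_eq_true a)] at h
      rcases List.mem_cons.1 hw with rfl | hw'
      · exact List.mem_cons_self
      · exact List.mem_cons_of_mem _ (mem_of_subWalk as bs h w hw')
    · rw [if_neg (by simpa using hab)] at h
      exact List.mem_cons_of_mem _ (mem_of_subWalk (a :: as) bs h w hw)

/-- Control: `[2, 5] ⊆ [1, 2, 3, 5, 8]` by the walk; a missing element is caught. -/
theorem subWalk_control : subWalk [2, 5] [1, 2, 3, 5, 8] = true ∧ subWalk [2, 4] [1, 2, 3, 5, 8] = false := by decide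

end Summit.Ventures.QEC.Census.Plane
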